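import Mathlib.Data.Nat.Bitwise

/-!
# ω-census, small STPP pattern `(2,1,1)^k`: the kernel mask search (engine; definitions only)

HONEST FRAMING (pub-omega census; verbatim): lottery ticket; floor = certified bounds/negative ranges.
Census STRUCTURE bookkeeping of the STPP track (seat pub-omega-stpp-3, gen 23; STRUCTURE row B5, the threshold
column `T1(H) = max {k : (2,1,1)^k ⊆ H}`), not progress on `ω`: small patterns in small groups bound no exponent.

This file is the group-independent ENGINE behind the kernel theorems «the finite abelian group `H` admits NO STPP family of
size pattern `(2,1,1)^k`» (CKSU 2005 Def. 5.1, tree form `IsSTPP`; `|Aᵢ| = 2`, `|Bᵢ| = |Cᵢ| = 1`).  It searches the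
DIFFERENCE MODEL of the tree's `exists_isSTPP_211_iff` (`STPPSmallPatternCriteria.lean`): `p q c : Fin k → H`,
`Aᵢ = {pᵢ, qᵢ}` pairwise disjoint pairs, and `x − y ≠ cⱼ − c_l` for `x ∈ Aᵢ`, `y ∈ A_l`, `j ≠ l`.
Soundness (reflection through Def. 5.1 and the normal form) is `STPPSmallPatternKernelReflect.lean`; nothing here is trusted.

* CODES.  Group elements are `ℕ`-codes `< n`; a SET of elements is the `ℕ` whose bit `x` is set for each member (a mask).
  The engine needs three code operations (`GC`): `tr M t` = the mask of the translate `S + t` of the set `S` of mask `M`,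
  `sub`, `neg` on codes.  For `ℤ/n` (`zcode n`: code = `ZMod.val`) `tr` is the cyclic ROTATION of the low `n` bits — five
  kernel-accelerated `ℕ` operations, which is what makes `decide +kernel` affordable.
* NORMAL FORM searched: `c₀ = 0 < c₁ < ⋯ < c_{k−1}` (codes), `A₀ = {0, d}` with `d` from a list of representatives,
  `pᵢ < qᵢ` (codes).  (Justified in the reflection file: translations of the `A`'s and of `c`, relabelling, automorphisms.)
* STATE (`St`, aggregate masks only): `U = ⋃ Aᵢ`, `E = ⋃_{j ≠ l} (A_l + cⱼ − c_l)`, `Fc = ⋃_l (c_l + (U − A_l))` (forbidden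
  values of the next `c`), `V = ⋃ⱼ (U − cⱼ)`, `W = ⋃_l (A_l − c_l)`, `X = ⋃_l (c_l − A_l)`, `Cm = {cⱼ}`, `NCm = {−cⱼ}`, `last`.
  Given the next `c`, the new pair must avoid `U ∪ E ∪ (c + V) ∪ (c + W)`, and `q − p ∉ {±(c − cⱼ)}`; all updates of the
  state by a new triple `(c, p, q)` are unions of translates of these aggregates (`child`).
* SEARCH (`search g k reps`, Boolean): depth-first, `c` over the set bits of the free-`c` mask (lowest first, via
  `Nat.log2` of the isolated lowest bit), then `p`, then `q`; the first level of each chunk `(d, x1)` skips the `c ∈ x1`; two ROOM tests (enough free `c`-values above, enough room for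
  the remaining pairs outside `U ∪ E`) prune hopeless children.  `true` = every branch below every `d ∈ reps` is refuted.
  All recursions are recursor applications and every computed mask is evaluated once (`force`), as in the `(2,2,2)³` engine
  `STPP222CubeEngine.lean` (ENG2) whose idioms this file follows.

References: H. Cohn, R. Kleinberg, B. Szegedy, C. Umans, *Group-theoretic algorithms for matrix multiplication*, FOCS 2005
(arXiv:math/0511460), Def. 5.1.  Record: pub-omega HOME `pub-omega-stpp-3-g23/` (Python mirror `k211v3.py`, counts).
-/

namespace Summit.MatrixMultiplication.OmegaCensus

namespace STPP211Neg

/-! ## 1. Codes, masks, rotation -/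

/-- Code operations of a group encoding used by the search: number of codes `n`, the all-codes mask `full = 2^n − 1`,
translation of a mask by a code, subtraction and negation of codes. -/
structure GC where
  /-- number of codes (the group order) -/ n : ℕ
  /-- the mask `2^n − 1` of all codes -/ full : ℕ
  /-- mask of the translate `S + t` from the mask of `S` and the code of `t` -/ tr : ℕ → ℕ → ℕ
  /-- code of `x − y` -/ sub : ℕ → ℕ → ℕ
  /-- code of `−x` -/ neg : ℕ → ℕ

/-- The single-bit mask `2^k`. -/
def bit (k : ℕ) : ℕ := Nat.shiftLeft 1 k

/-- The mask `2^k − 1` of all bits `< k`. -/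
def lowMask (k : ℕ) : ℕ := Nat.sub (Nat.shiftLeft 1 k) 1

/-- Cyclic rotation of the low `n` bits by `t ≤ n` (bit `x` moves to bit `(x + t) mod n`), for masks `< 2^n`:
`((M <<< t) ||| (M >>> (n − t))) &&& (2^n − 1)`. -/
def rot (n full M t : ℕ) : ℕ :=
  Nat.land (Nat.lor (Nat.shiftLeft M t) (Nat.shiftRight M (Nat.sub n t))) full

/-- The code operations of `ℤ/n` on `ZMod.val` codes: rotation, `(a + (n − b)) mod n`, `(n − a) mod n`. -/
def zcode (n : ℕ) : GC :=
  ⟨n, lowMask n, rot n (lowMask n), fun a b => Nat.mod (Nat.add a (Nat.sub n b)) n, fun a => Nat.mod (Nat.sub n a) n⟩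

/-- Evaluate `m` to a literal once, then continue with it (the kernel substitutes the evaluated predecessor;
idiom of `STPP222CubeSearch.lean`). -/
noncomputable def force {α : Type} (m : ℕ) (f : ℕ → α) : α :=
  @Nat.rec (fun _ => α) (f 0) (fun k _ => f (Nat.add k 1)) m

/-- `force m f = f m`. -/
theorem force_eq {α : Type} (m : ℕ) (f : ℕ → α) : force m f = f m := by
  cases m <;> rfl

/-- The lowest set bit of `F`, isolated (`0` if `F = 0`). -/
def lowBit (F : ℕ) : ℕ := Nat.xor F (Nat.land F (Nat.sub F 1))

/-- Conjunction of `body x` over the set bits `x` of `F`, lowest first, at most `fuel` of them — called with `fuel = F`,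
which always suffices (recursor form; the index of an isolated bit is read by the kernel-accelerated `Nat.log2`). -/
noncomputable def allBits (fuel : ℕ) (body : ℕ → Bool) : ℕ → Bool :=
  @Nat.rec (fun _ => ℕ → Bool) (fun _ => true)
    (fun _ ih F => @Bool.rec (fun _ => Bool)
      (force (lowBit F) fun L => body (Nat.log2 L) && ih (Nat.xor F L)) true (Nat.beq F 0))
    fuel

/-- `F` with its `r` lowest set bits cleared (recursor form). -/
noncomputable def dropBits (r F : ℕ) : ℕ :=
  @Nat.rec (fun _ => ℕ) F (fun _ ih => force ih fun G => Nat.land G (Nat.sub G 1)) r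

/-- `F` has at least `r` set bits. -/
noncomputable def hasBits (r F : ℕ) : Bool :=
  @Nat.rec (fun _ => Bool) true (fun r' _ => !(Nat.beq (dropBits r' F) 0)) r

/-! ## 2. Search state and the child update -/

/-- Search state after some triples `(cⱼ, {pⱼ, qⱼ})` (aggregate masks; see the file header): -/
structure St where
  /-- code of the last `c` -/ last : ℕ
  /-- `⋃ Aᵢ` -/ U : ℕ
  /-- `⋃_{j ≠ l} (A_l + cⱼ − c_l)` -/ E : ℕ
  /-- `⋃_l (c_l + (U − A_l))` -/ Fc : ℕ
  /-- `⋃ⱼ (U − cⱼ)` -/ V : ℕ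
  /-- `⋃_l (A_l − c_l)` -/ W : ℕ
  /-- `⋃_l (c_l − A_l)` -/ X : ℕ
  /-- `{cⱼ}` -/ Cm : ℕ
  /-- `{−cⱼ}` -/ NCm : ℕ

/-- The empty state (no triple yet). -/
def St.empty : St := ⟨0, 0, 0, 0, 0, 0, 0, 0, 0⟩

/-- CHILD: extend the state `S` by the triple `(c, {p, q})` and continue with `k`, unless a ROOM test fails (then `true`
= refuted): after the new `Fc`, at least `r` free `c`-codes above `c`; after the new `E`, at least `2 r` free codes outside
`U ∪ E` — `r` = number of triples still to be placed after this one.  `Wc = W + c`, `Uc = U − c`, `CmC = Cm − c` are the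
per-`c` shared translates. -/
noncomputable def child (g : GC) (S : St) (r c p q Wc Uc CmC : ℕ) (k : St → Bool) : Bool :=
  force (Nat.lor (bit p) (bit q)) fun P =>
  force (Nat.lor S.U P) fun U2 =>
  force (Nat.lor (Nat.lor (Nat.lor (Nat.lor S.Fc (g.tr S.X p)) (g.tr S.X q)) (g.tr U2 (g.sub c p))) (g.tr U2 (g.sub c q)))
    fun Fc2 =>
  !(hasBits r (Nat.xor g.full (Nat.lor Fc2 (Nat.land (lowMask (Nat.add c 1)) g.full)))) ||
  force (Nat.lor (Nat.lor (Nat.lor S.E Wc) (g.tr CmC p)) (g.tr CmC q)) fun E2 =>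
  !(hasBits (Nat.mul 2 r) (Nat.xor g.full (Nat.lor U2 E2))) ||
  force (Nat.lor (Nat.lor (Nat.lor (Nat.lor (Nat.lor S.V (g.tr S.NCm p)) (g.tr S.NCm q)) Uc) (bit (g.sub p c)))
      (bit (g.sub q c))) fun V2 =>
  force (Nat.lor (Nat.lor S.W (bit (g.sub p c))) (bit (g.sub q c))) fun W2 =>
  force (Nat.lor (Nat.lor S.X (bit (g.sub c p))) (bit (g.sub c q))) fun X2 =>
  force (Nat.lor S.Cm (bit c)) fun Cm2 =>
  force (Nat.lor S.NCm (bit (g.neg c))) fun NCm2 =>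
  k ⟨c, U2, E2, Fc2, V2, W2, X2, Cm2, NCm2⟩

/-! ## 3. The search -/

/-- One level below the state `S` with `r + 1` triples still to place, the children searched by `k` (which refutes a
child state with `r` triples to place): every `c` (free, above `last`, not in the chunk restriction `x1`, with `r` free
`c`-codes above it), every `p` outside `U ∪ E ∪ (c + V) ∪ (c + W)`, every `q > p` outside that set and with
`q − p ∉ {±(c − cⱼ)}` leads to a refuted child. -/
noncomputable def level (g : GC) (S : St) (r x1 : ℕ) (k : St → Bool) : Bool :=
  force (Nat.xor g.full (Nat.lor S.Fc (Nat.land (lowMask (Nat.add S.last 1)) g.full))) fun freeC =>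
  allBits freeC (fun c =>
    Nat.testBit x1 c ||
    !(hasBits r (Nat.shiftRight freeC (Nat.add c 1))) ||
    force (Nat.lor (Nat.lor S.U S.E) (g.tr (Nat.lor S.V S.W) c)) fun Mc =>
    force (Nat.xor g.full Mc) fun freeP =>
    Nat.beq freeP 0 ||
    force (g.tr S.Cm (g.neg c)) fun CmC =>
    force (Nat.lor (g.tr S.NCm c) CmC) fun Dm =>
    force (g.tr S.W c) fun Wc =>
    force (g.tr S.U (g.neg c)) fun Uc =>
    allBits freeP (fun p =>
      force (Nat.xor g.full (Nat.lor (Nat.lor Mc (g.tr Dm p)) (Nat.land (lowMask (Nat.add p 1)) g.full))) fun freeQ =>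
      allBits freeQ (fun q => child g S r c p q Wc Uc CmC k) freeQ)
      freeP)
    freeC

/-- The search below a state with `r` triples still to place: `true` = every completion is refuted (a state with
nothing left to place is a full configuration and returns `false`).  No chunk restriction below the first level. -/
noncomputable def below (g : GC) : ℕ → St → Bool :=
  @Nat.rec (fun _ => St → Bool) (fun _ => false) (fun r ih S => level g S r 0 ih)

/-- The search below the start state, `r` triples to place, the FIRST level restricted to `c ∉ x1` (chunking). -/
noncomputable def belowX (g : GC) (r x1 : ℕ) : St → Bool :=
  @Nat.rec (fun _ => St → Bool) (fun _ => false) (fun r' _ S => level g S r' x1 (below g r')) r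

/-- The start state of the representative `d` (`c₀ = 0`, `A₀ = {0, d}`; same update as `child`, from the empty state,
with the room tests for the `r` further triples), continued by `k`. -/
noncomputable def start (g : GC) (r d : ℕ) (k : St → Bool) : Bool :=
  child g St.empty r 0 0 d 0 0 0 k

/-- THE SEARCH for the size pattern `(2,1,1)^k` over the chunks `(d, x1)` (representative `d` of `A₀ = {0, d}`, first-level
exclusion mask `x1`): `true` certifies that no normal-form solution of the difference model with `d` listed and `c₁ ∉ x1`
exists (reflection file; the chunks of each `d` must cover all codes). -/
noncomputable def search (g : GC) (k : ℕ) (chunks : List (ℕ × ℕ)) : Bool :=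
  @List.rec (ℕ × ℕ) (fun _ => Bool) true
    (fun e _ ih => start g (Nat.sub k 1) e.1 (belowX g (Nat.sub k 1) e.2) && ih) chunks

/-- `search` on a cons (used to split kernel evaluations by chunk). -/
theorem search_cons (g : GC) (k : ℕ) (e : ℕ × ℕ) (R : List (ℕ × ℕ)) :
    search g k (e :: R) = (start g (k - 1) e.1 (belowX g (k - 1) e.2) && search g k R) := rfl

/-- `search` is a conjunction over the chunk list. -/
theorem search_append (g : GC) (k : ℕ) (R₁ R₂ : List (ℕ × ℕ)) :
    search g k (R₁ ++ R₂) = (search g k R₁ && search g k R₂) := by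
  induction R₁ with
  | nil => rfl
  | cons e R ih => rw [List.cons_append, search_cons, search_cons, ih, Bool.and_assoc]

end STPP211Neg

end Summit.MatrixMultiplication.OmegaCensus
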